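import Literature.IUT.HodgeTheaters.TemperedCoveringsProofs
import HarnessLib

/-!
# [IUTchI] Prop. 2.4 (i), (ii): the printed proofs as kernel inferences over the tower of coverings `X_J`

Mochizuki, *Inter-universal Teichmüller theory I*, kurims manuscript (May 2020), §2, Proposition 2.4
(i) "Profinite Conjugates of Nontrivial Arithmetic Compact Subgroups", p. 50: "Let `Λ ⊆ Δ^tp_X` be a
nontrivial pro-`Σ` compact subgroup, `γ ∈ Π̂_X` an element such that `γ·Λ·γ⁻¹ ⊆ Δ^tp_X`.  Then
`γ ∈ Π^tp_X`." ([IUTchI] Prop 2.4(i) p.50) [claim: Mochizuki2012, status: disputed] (D-0012 claim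
key; nothing of the series is asserted here).  PROOF-ONLY companion of abc-iut-L5-t1's
`TemperedCoverings.lean` (p405450): the typed predicate `StableCurveTemperedData.Prop24i D` is
PROVED from the inputs of the printed proof (p. 50, l. 25–42), each an explicit hypothesis indexed
by the levels `J` ("a finite index characteristic open subgroup `J ⊆ Δ^tp_X`", with `𝔾_J` "the
pro-`Σ` semi-graph of anabelioids associated to the special fiber of the stable model … of the finite
étale covering of `X ×_k k̄` determined by `J`"):

* the LEVEL DATA: `J ⊆ Δ^tp_X` (`Jtp`, closed), its closure `Ĵ ⊆ Π̂_X` (`Jhat`, with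
  `Ĵ ∩ Δ^tp_X = J` — `hJ`, `hJJ`), the pair `Π^tp_{𝔾_J} ↪ Π̂_{𝔾_J}` (a `TemperedGraphGroupData`,
  `G`), the surjection `J ↠ Π^tp_{𝔾_J}` (`πtp`, continuous, surjective) and "the natural surjection
  on pro-`Σ̂` completions `Ĵ ↠ Π̂_{𝔾_J}`" (`πhat`), compatibly (`hcomp`);
* (L1) = "it thus follows from Proposition 2.1 [applied to `𝔾_J`]" — Prop. 2.1 for each `𝔾_J`
  (`h21`; itself reduced to [SemiAnbd] Thm 3.7 (iii) + [NodNon] Lem 1.9 (ii) in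
  `TemperedCoveringsProTree.lean`);
* (L2) = "since `Δ̂_X` is strongly torsion-free [[Config] Rmk 1.2.2], … `J ∩ Λ` has nontrivial image
  in the pro-`Σ` completion of the abelianization of `J`, hence in `Π^tp_{𝔾_J}` [since … `p ∉ Σ`
  implies that the surjection `J ↠ Π^tp_{𝔾_J}` induces an isomorphism between the pro-`Σ`
  completions of the respective abelianizations]" — typed as its conclusion at every level used:
  `J ∩ Λ` has nontrivial image in `Π^tp_{𝔾_J}` (`hL2`; the text needs it for all sufficiently small
  `J`, which is what the inverse-limit step consumes);
* (L3) = "Since the quotient `Π^tp_X` surjects onto `G_k`, and `J` is open of finite index in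
  `Δ^tp_X`, we may assume without loss of generality that `γ` lies in the closure `Ĵ` of `J` in
  `Π̂_X`" — `Π̂_X = ι(Π^tp_X)·Ĵ` (`hL3`);
* (INV) = "Since, by allowing `J` to vary, `Π^tp_X` (respectively, `Π̂_X`) may be written as an
  inverse limit of the topological groups `Π^tp_X/Ker(J ↠ Π^tp_{𝔾_J})` (respectively,
  `Π̂_X/Ker(Ĵ ↠ Π̂_{𝔾_J})`), we thus conclude that [the original] `γ` lies in `Π^tp_X`" — an element
  of `Π̂_X` that is tempered modulo `Ker(Ĵ ↠ Π̂_{𝔾_J})` at every level is tempered (`hINV`).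

Main declarations: `StableCurveTemperedData.prop24i_of_levels`; and, for (ii) (p. 50 l. 43 – p. 51
l. 13, `Σ̂ = 𝔓𝔯𝔦𝔪𝔢𝔰`), `StableCurveTemperedData.prop24ii_of_levels` — the tower step over the quotients
`Π^tp_X/Ker(J ↠ Π^tp_{𝔾*_J})`, from the level-wise "observation" (itself the arithmetic analogue of
Prop. 2.1: `TemperedGraphGroupData.mem_range_of_proTree` of `TemperedCoveringsProTree.lean` with
admissible = open image in `G_k`, [SemiAnbd] Thm 5.4 (ii), distance `≤ 2`) and (INV).
For (i) the kernel-checked content is the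
text's bookkeeping: the translate `δ = ι(t)⁻¹γ ∈ Ĵ` still conjugates `Λ` into `ι(Δ^tp_X)`
(normality of `Δ^tp_X`), `δ·(J ∩ Λ)·δ⁻¹ ⊆ Ĵ ∩ ι(Δ^tp_X) = ι(J)`, so Prop. 2.1 for `𝔾_J` applies to the
compact nontrivial image of `J ∩ Λ` and the image `δ̄` of `δ`, giving `δ̄ ∈ Π^tp_{𝔾_J}`, i.e.
`ι(t j)⁻¹ γ ∈ Ker(Ĵ ↠ Π̂_{𝔾_J})` for some `j ∈ J`; (INV) concludes.  (Prop. 2.4 (iii) ⇐ (i) and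
Cor. 2.5 ⇐ Prop. 2.4 are in `TemperedCoveringsProofs.lean` / `TemperedCoveringsCompactSubgroups.lean`,
abc-iut-L5-t11 p406834 / p407271.)

What this file is NOT: not a discharge of the node IUTchI:Prop2.4(i) — (L2) rests on [Config]
Rmk 1.2.2 and the `p ∉ Σ` abelianization comparison, (INV)/(L3)/`Ĵ ∩ Δ^tp_X = J` on the structure
of the tempered/profinite tower (merge obligations over L3/L4 objects), (L1) on Prop. 2.1.
Nothing here bears on [IUTchIII] Cor. 3.12; typed ≠ discharged.
-/

namespace Literature.IUT.HodgeTheaters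

open Pointwise Filter
open _root_.Topology
open Literature.AnabelianGeometry.SemiGraphs (IsProSigma)

universe u

namespace StableCurveTemperedData

variable (D : StableCurveTemperedData.{u})

/-- **[IUTchI] Proposition 2.4 (i) from its printed inputs** (proof of p. 50, l. 25–42), over
an abstract tower of levels `i` (the characteristic open subgroups `J ⊆ Δ^tp_X`): level data
`Jtp`/`Jhat`/`G`/`πtp`/`πhat` as in the module docstring, with `Ĵ ∩ Δ^tp_X = J` (`hJ`, `hJJ`) and
the compatibility `hcomp` of `J ↠ Π^tp_{𝔾_J}` with `Ĵ ↠ Π̂_{𝔾_J}`; hypotheses (L1) Prop. 2.1 for every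
`𝔾_J` (`h21`), (L2) `J ∩ Λ` has nontrivial image in `Π^tp_{𝔾_J}` (`hL2`), (L3) `Π̂_X = ι(Π^tp_X)·Ĵ`
(`hL3`), (INV) temperedness is detected modulo the kernels `Ker(Ĵ ↠ Π̂_{𝔾_J})` (`hINV`).
Conclusion: abc-iut-L5-t1's predicate `Prop24i D` AS TYPED.
([IUTchI] Prop 2.4(i) p.50) [claim: Mochizuki2012, status: disputed] -/
theorem prop24i_of_levels {I : Type*}
    (Jtp : I → Subgroup D.DeltaTp)
    (hJc : ∀ i, IsClosed ((Jtp i : Subgroup D.DeltaTp) : Set D.DeltaTp))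
    (Jhat : I → Subgroup D.PiHat)
    (hJ : ∀ i (x : D.DeltaTp), x ∈ Jtp i → D.ιX (x : D.PiTp) ∈ Jhat i)
    (hJJ : ∀ i (x : D.DeltaTp), D.ιX (x : D.PiTp) ∈ Jhat i → x ∈ Jtp i)
    (G : I → TemperedGraphGroupData.{u})
    (πtp : ∀ i, Jtp i →* (G i).Tp) (hπc : ∀ i, Continuous (πtp i))
    (hπs : ∀ i, Function.Surjective (πtp i))
    (πhat : ∀ i, Jhat i →* (G i).Hat)
    (hcomp : ∀ i (x : D.DeltaTp) (hx : x ∈ Jtp i),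
      (G i).ι (πtp i ⟨x, hx⟩) = πhat i ⟨D.ιX (x : D.PiTp), hJ i x hx⟩)
    (h21 : ∀ i, (G i).ProfiniteConjugatesOfCompactSubgroups)
    (hL2 : ∀ Λ : Subgroup D.DeltaTp, IsCompact (Λ : Set D.DeltaTp) → Λ ≠ ⊥ →
      IsProSigma D.graph.Sigma Λ → ∀ i, ∃ x ∈ Λ, ∃ hx : x ∈ Jtp i, πtp i ⟨x, hx⟩ ≠ 1)
    (hL3 : ∀ i (γ : D.PiHat), ∃ t : D.PiTp, (D.ιX t)⁻¹ * γ ∈ Jhat i)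
    (hINV : ∀ γ : D.PiHat,
      (∀ i, ∃ (t : D.PiTp) (h : (D.ιX t)⁻¹ * γ ∈ Jhat i), πhat i ⟨(D.ιX t)⁻¹ * γ, h⟩ = 1) →
      γ ∈ D.ιX.range) :
    D.Prop24i := by
  refine ⟨fun Λ hΛc hΛne hΛS γ hγ => hINV γ fun i => ?_⟩
  -- move `γ` into `Ĵ_i` by a tempered element: `δ := ι(t)⁻¹ γ ∈ Ĵ_i`
  obtain ⟨t, hδ⟩ := hL3 i γ
  set δ : D.PiHat := (D.ιX t)⁻¹ * γ with hδdef
  -- `δ` still conjugates `Λ` into `ι(Δ^tp_X)` (`Δ^tp_X` is normal in `Π^tp_X`)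
  have hδΛ : ∀ l ∈ Λ, ∃ m : D.DeltaTp, δ * D.ιX (l : D.PiTp) * δ⁻¹ = D.ιX (m : D.PiTp) := by
    intro l hl
    obtain ⟨m₀, hm₀, hm₀eq⟩ := Subgroup.mem_map.mp (hγ l hl)
    have hm : t⁻¹ * m₀ * t ∈ D.DeltaTp := by
      have := (MonoidHom.normal_ker D.prTp).conj_mem m₀ hm₀ t⁻¹
      simpa using this
    refine ⟨⟨t⁻¹ * m₀ * t, hm⟩, ?_⟩
    simp only [hδdef, map_mul, map_inv, hm₀eq, mul_inv_rev, inv_inv]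
    group
  -- the compact nontrivial subgroup `K := π_i(Λ ∩ J_i) ⊆ Π^tp_{𝔾_i}`
  set Λi : Subgroup (Jtp i) := Λ.subgroupOf (Jtp i) with hΛi
  set K : Subgroup (G i).Tp := Λi.map (πtp i) with hK
  have hΛic : IsCompact (Λi : Set (Jtp i)) := by
    have : (Λi : Set (Jtp i)) = ((↑) : Jtp i → D.DeltaTp) ⁻¹' (Λ : Set D.DeltaTp) := rfl
    rw [this]
    exact (hJc i).isClosedEmbedding_subtypeVal.isCompact_preimage hΛc
  have hKc : IsCompact (K : Set (G i).Tp) := by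
    rw [hK, Subgroup.coe_map]
    exact hΛic.image (hπc i)
  have hKne : K ≠ ⊥ := by
    obtain ⟨x, hx, hxJ, hx1⟩ := hL2 Λ hΛc hΛne hΛS i
    intro hbot
    apply hx1
    have : πtp i ⟨x, hxJ⟩ ∈ K := Subgroup.mem_map_of_mem _ (by exact hx)
    rwa [hbot, Subgroup.mem_bot] at this
  -- Prop 2.1 for `𝔾_i`, applied to `K` and the image `δ̄` of `δ`
  set δbar : (G i).Hat := πhat i ⟨δ, hδ⟩ with hδbar
  have hconj : ∀ k ∈ K, δbar * (G i).ι k * δbar⁻¹ ∈ (G i).ι.range := by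
    rintro _ ⟨⟨x, hxJ⟩, hx, rfl⟩
    have hxΛ : (x : D.DeltaTp) ∈ Λ := hx
    obtain ⟨m, hm⟩ := hδΛ x hxΛ
    -- `δ ι(x) δ⁻¹ ∈ Ĵ_i`, hence `m ∈ J_i`
    have hprod : δ * D.ιX (x : D.PiTp) * δ⁻¹ ∈ Jhat i :=
      (Jhat i).mul_mem ((Jhat i).mul_mem hδ (hJ i x hxJ)) ((Jhat i).inv_mem hδ)
    have hmJ : m ∈ Jtp i := hJJ i m (hm ▸ hprod)
    refine ⟨πtp i ⟨m, hmJ⟩, ?_⟩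
    rw [hcomp i x hxJ, hδbar, ← map_mul, ← map_inv, ← map_mul, hcomp i m hmJ]
    congr 1
    apply Subtype.ext
    simp only [Subgroup.coe_mul, Subgroup.coe_inv]
    exact hm.symm
  have hδrange : δbar ∈ (G i).ι.range := (h21 i).mem_of_conj_le K hKc hKne δbar hconj
  -- `δ̄ = ι_i(π_i(j))` for some `j ∈ J_i`; then `ι(t j)⁻¹ γ ∈ Ker(Ĵ_i → Π̂_{𝔾_i})`
  obtain ⟨y, hy⟩ := hδrange
  obtain ⟨⟨j, hjJ⟩, rfl⟩ := hπs i y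
  rw [hcomp i j hjJ] at hy
  have hmem : (D.ιX (t * (j : D.PiTp)))⁻¹ * γ ∈ Jhat i := by
    have : (D.ιX (t * (j : D.PiTp)))⁻¹ * γ = (D.ιX (j : D.PiTp))⁻¹ * δ := by
      simp only [hδdef, map_mul, mul_inv_rev, mul_assoc]
    rw [this]
    exact (Jhat i).mul_mem ((Jhat i).inv_mem (hJ i j hjJ)) hδ
  refine ⟨t * (j : D.PiTp), hmem, ?_⟩
  have : (⟨(D.ιX (t * (j : D.PiTp)))⁻¹ * γ, hmem⟩ : Jhat i) =
      ⟨D.ιX (j : D.PiTp), hJ i j hjJ⟩⁻¹ * ⟨δ, hδ⟩ := by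
    apply Subtype.ext
    simp only [Subgroup.coe_mul, Subgroup.coe_inv, hδdef, map_mul, mul_inv_rev, mul_assoc]
  rw [this, map_mul, map_inv, hy, ← hδbar, inv_mul_cancel]

/-- **[IUTchI] Proposition 2.4 (ii), the tower step** (proof of p. 50 l. 43 – p. 51 l. 13: "by
applying [the evident analogue of] this observation to the quotients
`Π^tp_X ↠ Π^tp_X/Ker(J ↠ Π^tp_{𝔾*_J})` — where `J ⊆ Δ^tp_X` is a finite index characteristic open
subgroup, and `𝔾*_J` is the semi-graph of anabelioids whose finite étale coverings correspond to
arbitrary admissible coverings of the special fiber … — we conclude that `γ ∈ Π^tp_X`").  Levels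
`j`: the quotient pair `Π^tp_X/Ker(J ↠ Π^tp_{𝔾*_J}) ↪ Π̂_X/Ker(Δ̂_X ↠ Π̂_{𝔾*_J})` (a
`TemperedGraphGroupData`, `Q j`) with the quotient maps `qtp j`, `qhat j` (compatible, `hq`);
hypotheses: (OBS) "this observation" at level `j` — for `Λ ⊆ Π^tp_X` compact, nontrivial, with open
image in `G_k`, an element of `Π̂_X/Ker(…)` conjugating the image of `Λ` into the tempered quotient
is tempered (`hLev`; the text obtains it "from a similar argument to the argument applied to prove
Proposition 2.1" with [SemiAnbd] Thm 5.4 (ii) / Ex 5.6 and vertices that "coincide, are adjacent,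
or admit a common adjacent vertex" — i.e. `TemperedGraphGroupData.mem_range_of_proTree` with
`Adm Λ` = open image in `G_k` and `Near` = distance `≤ 2`); (INV) an element of `Π̂_X` that is
tempered in every level quotient is tempered (`hINV`, "[just as in the proof of assertion (i)]").
Conclusion: abc-iut-L5-t1's predicate `Prop24ii D` AS TYPED (its hypothesis `Σ̂ = 𝔓𝔯𝔦𝔪𝔢𝔰` is where
the text needs `𝔾*_J`; the kernel step does not use it).
([IUTchI] Prop 2.4(ii) p.50) [claim: Mochizuki2012, status: disputed] -/
theorem prop24ii_of_levels {I : Type*} (Q : I → TemperedGraphGroupData.{u})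
    (qtp : ∀ j, D.PiTp →* (Q j).Tp) (qhat : ∀ j, D.PiHat →* (Q j).Hat)
    (hq : ∀ j (t : D.PiTp), (Q j).ι (qtp j t) = qhat j (D.ιX t))
    (hLev : ∀ j (Λ : Subgroup D.PiTp), IsCompact (Λ : Set D.PiTp) → Λ ≠ ⊥ →
      IsOpen (Λ.map D.prTp : Set D.Gk) →
      ∀ δ : (Q j).Hat, (∀ l ∈ Λ, δ * qhat j (D.ιX l) * δ⁻¹ ∈ (Q j).ι.range) → δ ∈ (Q j).ι.range)
    (hINV : ∀ γ : D.PiHat, (∀ j, qhat j γ ∈ (Q j).ι.range) → γ ∈ D.ιX.range) :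
    D.Prop24ii := by
  refine ⟨fun _ Λ hΛc hΛne hΛo γ hγ => hINV γ fun j => ?_⟩
  refine hLev j Λ hΛc hΛne hΛo (qhat j γ) fun l hl => ?_
  obtain ⟨m, hm⟩ := hγ l hl
  refine ⟨qtp j m, ?_⟩
  rw [hq, hm, map_mul, map_mul, map_inv]

end StableCurveTemperedData

end Literature.IUT.HodgeTheaters
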